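import Summits.BirchSwinnertonDyer.BirchSwinnertonDyer.Theorems.KimAtThreeD7uTamagawaTateIndex
import Summits.BirchSwinnertonDyer.Rank1Residual.X11b.ZpLineIndexTorsion
import Literature.NumberTheory.EllipticCurves.PadicPointsFiniteIndexProofs
import Mathlib.NumberTheory.Padics.HeightOneSpectrum
import HarnessLib

/-!
# The Tamagawa index AT THE TATE MODULE, III — the ORDERS: `#H¹(ℚ_w, T_pE) = #E(ℚ_w)[p^∞]` (finite)
# and `#H¹_ur(ℚ_w, T_pE) · p^{v_p(c_w)} = #E(ℚ_w)[p^∞]` at every finite `w ∤ p`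
# (cell `bsd-addord`, seat w2-tamdiv gen 8; route W2 `KimAtThreeKolyvagin`, items 19562 / 19560, «TamDiv∞»)

HONEST FRAMING: TOOL theorems (no definition, no named fact, no `sorry`); closes nothing by itself;
nothing is booked; BSD is not proved by any of this.  Part XXIX of the seat's series.  Parts XXVII–XXVIII
(`KimAtThreeD7uTamagawaTate{Unramified,Index}`) proved `[H¹(ℚ_w, T_pE) : H¹_ur(ℚ_w, T_pE)] = p^{v_p(c_w)}` and
named as NOT DONE the order of `H¹(ℚ_w, T_pE)` itself — the integral shadow of «`H¹(ℚ_ℓ, V_pE) = 0` for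
`ℓ ≠ p`», the remark the tree's `KolyvaginSystems.lean` leaves to consumers («`H¹_f(ℚ_ℓ, T) = H¹(ℚ_ℓ, T)`
because `H¹(ℚ_ℓ, V_pE) = 0`»).  This file proves it:

* §1 **`eq_zero_of_forall_tateLocalMap_eq_zero`** — at ANY place `v` of `ℚ` and for ANY prime `p`,
  `H¹(ℚ_v, T_pE) → lim_k H¹(ℚ_v, E[p^k · p])` is injective: a class all of whose reductions vanish is `0`
  (König / `lim¹_k E[p^k] = 0`, the argument of part XXVII §1 for the whole group instead of `I_w`).
* §2 **`finite_torsion_point_adicCompletion`** — `E(ℚ_w)_tors` is finite for `ℚ_w = w.adicCompletion ℚ`: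
  transport of the tree's AEC VII.6.3 for `ℚ_ℓ` (`exists_finiteIndex_addEquiv_padicInt_holds`, a finite-index
  `ℤ_ℓ`-line in `E(ℚ_ℓ)`; x11b `LocalIndex.finite_torsion`) along Mathlib's continuous `ℚ`-algebra
  isomorphism `ℚ_w ≃ ℚ_ℓ` (`Rat.HeightOneSpectrum.adicCompletion.padicEquiv`) and the injective map on points
  (`WeierstrassCurve.Affine.Point.map_injective`); hence `#E(ℚ_w)[p^∞] = p^t`, `t := v_p(#E(ℚ_w)_tors)`.
* §3 `natCard_propagatedSelmerStructure_inr_eq_natCard_ker_nsmul` (`#𝓕_can(w)_k = #E(ℚ_w)[p^{k+1}]`, n1011's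
  Kummer identification + Milne I Lemma 3.3, as in part V §3) and
  `natCard_propagatedSelmerStructure_inr_eq_pow_of_dvd` (`= p^t` once `p^t ∣ p^{k+1}`).
* §4 ★★ **`tateLocalMap_injective_of_dvd`** (at `w ∤ p`, `p^t ∣ p^{k+1}`: `π_{k+1,*} : H¹(ℚ_w, T_pE) ↪
  H¹(ℚ_w, E[p^k · p])` is INJECTIVE — a `T_pE`-class is determined by one deep reduction; surjective
  `red`-tower of part XXVII with equal orders `p^t` past the threshold + §1), ★★★
  **`natCard_cohomology_tate_eq_pow_padicValNat`** (`#H¹(ℚ_w, T_pE) = p^{v_p(#E(ℚ_w)_tors)} = #E(ℚ_w)[p^∞]`,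
  `natCard_cohomology_tate_eq_natCard_primaryComponent`; in particular `finite_cohomology_tate`), and with
  part XXVIII ★★ **`natCard_unramifiedSubgroup_tate_mul_pow_eq`** (`#H¹_ur(ℚ_w, T_pE) · p^{v_p(c_w)} = p^t`) and the
  arithmetic corollary **`pow_padicValNat_localTamagawaNumber_dvd_natCard_primaryComponent`**
  (`p^{v_p(c_w)} ∣ #E(ℚ_w)[p^∞]`: the `p`-part of the Tamagawa number divides the local `p`-power torsion).
  Numerically this is Tate local duality / the local Euler characteristic for `T_pE` at `ℓ ≠ p`
  (`#H¹(ℚ_ℓ, T_pE) = #H²(ℚ_ℓ, T_pE) = #E(ℚ_ℓ)[p^∞]`, `H⁰ = 0`), obtained here without duality.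

References: K. Rubin, *Euler Systems* (2000) Lemma 1.3.2, Lemma 1.3.5, Prop. B.2.3; J. S. Milne, *ADT* I
Lemma 3.3, Cor. 2.3, Thm. 2.8; J. Neukirch, A. Schmidt, K. Wingberg (2008) (2.7.5), Thm. 7.3.10; B. Mazur,
K. Rubin, Mem. AMS 799 (2004) App. A Remark A.5; K. Büyükboduk, JNT 129 (2009) §2.1.2 Remark 2;
J. H. Silverman, AEC VII.6.1, VII.6.3.
-/

noncomputable section

-- the cell's Theorems namespace `Summit.BirchSwinnertonDyer.BirchSwinnertonDyer.…` repeats the summit name by design (D-0017)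
set_option linter.dupNamespace false

open CategoryTheory Function Field IsDedekindDomain NumberField
open scoped NumberField Classical ContRepresentation
open Literature.NumberTheory.GaloisRepresentations Literature.NumberTheory.EllipticCurves
open Literature.NumberTheory.GaloisRepresentations.IsNonarchimedeanLocalField
open Literature.NumberTheory.GaloisCohomology
open WeierstrassCurve
open Summit.BirchSwinnertonDyer.Rank1Residual.GaloisImage
open Summit.BirchSwinnertonDyer.Rank1Residual.X11b
open Summit.BirchSwinnertonDyer.BirchSwinnertonDyer.Theorems.KimAtThreeDeepUpperOffStratumLocalIndex
open Summit.BirchSwinnertonDyer.BirchSwinnertonDyer.Theorems.KimAtThreeD7uBlochKatoCondition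
open Summit.BirchSwinnertonDyer.BirchSwinnertonDyer.Theorems.KimAtThreeD7uTamagawaFreeTate
open Summit.BirchSwinnertonDyer.BirchSwinnertonDyer.Theorems.KimAtThreeD7uTamagawaTateUnramified
open Summit.BirchSwinnertonDyer.BirchSwinnertonDyer.Theorems.KimAtThreeD7uTamagawaTateIndex

namespace Summit.BirchSwinnertonDyer.BirchSwinnertonDyer.Theorems.KimAtThreeD7uTamagawaTateOrder

variable (W : WeierstrassCurve ℚ) [W.IsElliptic] (p : ℕ) [hp : Fact p.Prime]

/-! ### §1 `H¹(ℚ_v, T_pE) ↪ lim_k H¹(ℚ_v, E[p^k · p])` (`lim¹ = 0`, König), any place -/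

/-- **A `T_pE`-class all of whose reductions vanish is zero** (`lim¹_k E[p^k] = 0`): for `W/ℚ` elliptic,
ANY prime `p`, ANY place `v` of `ℚ` and `y ∈ H¹(ℚ_v, T_pE)`, if `π_{k+1,*} y = 0` in `H¹(ℚ_v, E[p^k · p])` for
every `k` then `y = 0`.  König's lemma (part III §1) on the tower of the finite non-empty sets
`S_{k+1} = {m ∈ E[p^k · p] | π_{k+1} ∘ η = ∂m}` (`η` a cocycle of `y`), mapped into each other by `[p]`, gives
a compatible `t = (m_k) ∈ T_pE` with `η = ∂t`. [cite: Rubin2000, App. B Prop. B.2.3]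
[cite: NeukirchSchmidtWingberg2008, II §7 (2.7.5)] -/
theorem eq_zero_of_forall_tateLocalMap_eq_zero (v : Place ℚ)
    (y : (tateLocalRep W p v).cohomology 1) (hy : ∀ k : ℕ, tateLocalMap W p k v y = 0) :
    y = 0 := by
  set θ : absoluteGaloisGroup (Place.Completion v) →ₜ* absoluteGaloisGroup ℚ :=
    absGaloisRestrict ℚ (Place.Completion v) with hθdef
  obtain ⟨η, rfl⟩ := oneCocycleClass_surjective _ y
  -- level `k+1`: `π_{k+1} ∘ η` is the coboundary of some `m ∈ E[p^k · p]`
  have hlevel : ∀ k : ℕ, ∃ m : geomPoints W, m ∈ geomTorsion W ((p : ℤ) ^ k * (p : ℤ)) ∧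
      ∀ τ : absoluteGaloisGroup (Place.Completion v), TateModule.proj p (k + 1) (η.1 τ) = θ τ • m - m := by
    intro k
    have hk : oneCocycleClass _ (pushCocycle W p k v η) = 0 := by
      have h := hy k
      rwa [tateLocalMap_oneCocycleClass] at h
    obtain ⟨m, hm⟩ := (oneCocycleClass_eq_zero_iff _ (pushCocycle W p k v η)).mp hk
    refine ⟨(m : geomPoints W), m.2, fun τ => ?_⟩
    have h := congrArg (fun z : geomTorsion W ((p : ℤ) ^ k * (p : ℤ)) => (z : geomPoints W)) (hm τ)
    rw [AddSubgroupClass.coe_sub] at h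
    exact (show TateModule.proj p (k + 1) (η.1 τ) =
      ((pushCocycle W p k v η).1 τ : geomPoints W) from rfl).trans h
  -- the tower of admissible reductions: `S 0 = {0}`, `S (k+1) = {m ∈ E[p^k·p] | π_{k+1} ∘ η = ∂m}`
  let S : ℕ → Set (geomPoints W) := fun n => Nat.casesOn n {0} fun k =>
    {m | m ∈ geomTorsion W ((p : ℤ) ^ k * (p : ℤ)) ∧
      ∀ τ : absoluteGaloisGroup (Place.Completion v), TateModule.proj p (k + 1) (η.1 τ) = θ τ • m - m}
  have hS0 : S 0 = {0} := rfl
  have hSsucc : ∀ k, S (k + 1) = {m | m ∈ geomTorsion W ((p : ℤ) ^ k * (p : ℤ)) ∧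
      ∀ τ : absoluteGaloisGroup (Place.Completion v),
        TateModule.proj p (k + 1) (η.1 τ) = θ τ • m - m} := fun k => rfl
  have hfin : ∀ n, (S n).Finite := by
    intro n
    cases n with
    | zero => rw [hS0]; exact Set.finite_singleton 0
    | succ k =>
      rw [hSsucc]
      have hne : ((p ^ (k + 1) : ℕ) : ℤ) ≠ 0 := by exact_mod_cast pow_ne_zero (k + 1) hp.out.ne_zero
      haveI : Finite (geomTorsion W ((p ^ (k + 1) : ℕ) : ℤ)) :=
        finite_torsionPoints_holds W (AlgebraicClosure ℚ) hne
      have hfinT : ((geomTorsion W ((p ^ (k + 1) : ℕ) : ℤ) : AddSubgroup (geomPoints W)) :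
          Set (geomPoints W)).Finite := Set.toFinite _
      refine hfinT.subset fun m hm => ?_
      exact (mem_geomTorsion_pow_mul_iff W p k m).mp hm.1
  have hne : ∀ n, (S n).Nonempty := by
    intro n
    cases n with
    | zero => exact ⟨0, by rw [hS0]; exact Set.mem_singleton 0⟩
    | succ k =>
      obtain ⟨m, hm, hmG⟩ := hlevel k
      exact ⟨m, by rw [hSsucc]; exact ⟨hm, hmG⟩⟩
  have hmap : ∀ n, ∀ a ∈ S (n + 1), (p : ℤ) • a ∈ S n := by
    intro n a ha
    rw [hSsucc] at ha
    obtain ⟨haT, haG⟩ := ha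
    cases n with
    | zero =>
      rw [hS0, Set.mem_singleton_iff]
      rw [mem_geomTorsion_iff, pow_zero, one_mul] at haT
      exact haT
    | succ k =>
      rw [hSsucc]
      refine ⟨zsmul_mem_geomTorsion_level W p k haT, fun τ => ?_⟩
      rw [← TateModule.smul_proj_succ, haG τ, smul_sub, natCast_zsmul, smul_comm]
  obtain ⟨a, haS, ha⟩ := exists_seq_of_finite_tower (fun m : geomPoints W => (p : ℤ) • m) hfin hne hmap
  -- the Tate vector `t = (a n)_n`
  have ha0 : a 0 = 0 := by have h := haS 0; rwa [hS0, Set.mem_singleton_iff] at h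
  have hator : ∀ n, p ^ n • a n = 0 := by
    intro n
    cases n with
    | zero => rw [ha0, smul_zero]
    | succ k =>
      have h := haS (k + 1)
      rw [hSsucc] at h
      have h' := (mem_geomTorsion_pow_mul_iff W p k (a (k + 1))).mp h.1
      rw [mem_geomTorsion_iff, natCast_zsmul] at h'
      exact h'
  have hacompat : ∀ n, p • a (n + 1) = a n := fun n => by rw [← natCast_zsmul]; exact ha n
  let t : W.tateModule p := TateModule.mk a hator hacompat
  -- `η = ∂t`
  refine (oneCocycleClass_eq_zero_iff _ η).mpr ⟨t, fun τ => ?_⟩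
  change η.1 τ = θ τ • t - t
  refine TateModule.ext fun n => ?_
  rw [map_sub, TateModule.proj_smul_of_distribMulAction, TateModule.proj_mk]
  cases n with
  | zero =>
    rw [ha0, smul_zero, sub_zero]
    have h := TateModule.pow_smul_proj 0 (η.1 τ)
    rwa [pow_zero, one_smul] at h
  | succ k =>
    have h := haS (k + 1)
    rw [hSsucc] at h
    exact h.2 τ

/-! ### §2 `E(ℚ_w)_tors` is finite (`ℚ_w = w.adicCompletion ℚ`; AEC VII.6.3 transported along `ℚ_w ≃ ℚ_ℓ`) -/

section Torsion

variable (w : HeightOneSpectrum (𝓞 ℚ))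

/-- **The torsion subgroup of `E(ℚ_w)` is finite** for the adic completion `ℚ_w = w.adicCompletion ℚ` of `ℚ` at a
finite place `w` (of residue characteristic `ℓ`): Mathlib's continuous `ℚ`-algebra isomorphism
`ℚ_w ≃ ℚ_ℓ` (`Rat.HeightOneSpectrum.adicCompletion.padicEquiv`) induces an injective homomorphism
`E(ℚ_w) → E(ℚ_ℓ)` (`WeierstrassCurve.Affine.Point.map`), and `E(ℚ_ℓ)_tors` is finite because `E(ℚ_ℓ)` has a
finite-index subgroup `≅ ℤ_ℓ` (the tree's AEC VII.6.3 `exists_finiteIndex_addEquiv_padicInt_holds`, x11b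
`LocalIndex.finite_torsion`). [cite: SilvermanAEC2009, VII.6.3] -/
theorem finite_torsion_point_adicCompletion :
    Finite (AddCommGroup.torsion (W.baseChange (w.adicCompletion ℚ)).toAffine.Point) := by
  haveI hℓ : Fact (Nat.Prime ((Rat.HeightOneSpectrum.primesEquiv w : Nat.Primes) : ℕ)) :=
    ⟨(Rat.HeightOneSpectrum.primesEquiv w).2⟩
  -- the `ℚ`-algebra map `ℚ_w → ℚ_ℓ` and the induced injective map on points
  let f : w.adicCompletion ℚ →ₐ[ℚ] ℚ_[((Rat.HeightOneSpectrum.primesEquiv w : Nat.Primes) : ℕ)] :=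
    (Rat.HeightOneSpectrum.adicCompletion.padicEquiv w).toAlgEquiv.toAlgHom
  let Φ := WeierstrassCurve.Affine.Point.map (W' := W.toAffine) f
  have hΦ : Function.Injective Φ := WeierstrassCurve.Affine.Point.map_injective (W' := W.toAffine) f
  -- finiteness over `ℚ_ℓ`
  obtain ⟨A, hA, ⟨φ⟩⟩ := exists_finiteIndex_addEquiv_padicInt_holds
    ((Rat.HeightOneSpectrum.primesEquiv w : Nat.Primes) : ℕ)
    (W.baseChange ℚ_[((Rat.HeightOneSpectrum.primesEquiv w : Nat.Primes) : ℕ)])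
  haveI := hA
  haveI hfin := LocalIndex.finite_torsion A φ
  refine Finite.of_injective
    (fun t : AddCommGroup.torsion (W.baseChange (w.adicCompletion ℚ)).toAffine.Point =>
      (⟨Φ t, Φ.isOfFinAddOrder t.2⟩ :
        AddCommGroup.torsion (W.baseChange ℚ_[((Rat.HeightOneSpectrum.primesEquiv w : Nat.Primes) : ℕ)]).toAffine.Point))
    fun a b hab => Subtype.ext (hΦ (congrArg Subtype.val hab))

/-- **`#E(ℚ_w)[p^∞] = p^{v_p(#E(ℚ_w)_tors)}`**: the `p`-primary part of `E(ℚ_w)` is that of its finite torsion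
subgroup. [cite: SilvermanAEC2009, VII.6.3] -/
theorem natCard_primaryComponent_point_adicCompletion_eq_pow :
    Nat.card (AddCommGroup.primaryComponent (W.baseChange (w.adicCompletion ℚ)).toAffine.Point p) =
      p ^ padicValNat p (Nat.card (AddCommGroup.torsion (W.baseChange (w.adicCompletion ℚ)).toAffine.Point)) := by
  haveI := finite_torsion_point_adicCompletion W w
  rw [← LocalIndex.natCard_primaryComponent_torsion _ p,
    Literature.NumberTheory.EllipticCurves.natCard_primaryComponent_eq_pow_padicValNat p]

/-- `E(ℚ_w)[p^∞]` is finite. [cite: SilvermanAEC2009, VII.6.3] -/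
theorem finite_primaryComponent_point_adicCompletion :
    Finite (AddCommGroup.primaryComponent (W.baseChange (w.adicCompletion ℚ)).toAffine.Point p) := by
  refine Nat.finite_of_card_ne_zero ?_
  rw [natCard_primaryComponent_point_adicCompletion_eq_pow W p w]
  exact pow_ne_zero _ hp.out.ne_zero

/-- At a level `k` with `#E(ℚ_w)[p^∞] ∣ p^{k+1}`, the `p^{k+1}`-torsion of `E(ℚ_w)` IS its `p`-primary part:
`#E(ℚ_w)[p^{k+1}] = p^{v_p(#E(ℚ_w)_tors)}`. [folklore] -/
theorem natCard_ker_nsmul_pow_eq_of_dvd (k : ℕ)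
    (hk : p ^ padicValNat p (Nat.card (AddCommGroup.torsion (W.baseChange (w.adicCompletion ℚ)).toAffine.Point)) ∣
      p ^ (k + 1)) :
    Nat.card (nsmulAddMonoidHom (p ^ (k + 1)) :
        (W.baseChange (w.adicCompletion ℚ)).toAffine.Point →+ (W.baseChange (w.adicCompletion ℚ)).toAffine.Point).ker =
      p ^ padicValNat p (Nat.card (AddCommGroup.torsion (W.baseChange (w.adicCompletion ℚ)).toAffine.Point)) := by
  set G := (W.baseChange (w.adicCompletion ℚ)).toAffine.Point with hG
  haveI := finite_primaryComponent_point_adicCompletion W p w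
  rw [← natCard_primaryComponent_point_adicCompletion_eq_pow W p w]
  refine Nat.card_congr (Equiv.subtypeEquivRight fun x => ?_)
  change x ∈ (nsmulAddMonoidHom (p ^ (k + 1)) : G →+ G).ker ↔ x ∈ AddCommGroup.primaryComponent G p
  rw [AddMonoidHom.mem_ker, nsmulAddMonoidHom_apply, AddCommGroup.mem_primaryComponent]
  constructor
  · exact fun h => ⟨k + 1, h⟩
  · rintro ⟨m, hm⟩
    have hxmem : x ∈ AddCommGroup.primaryComponent G p := (AddCommGroup.mem_primaryComponent).mpr ⟨m, hm⟩
    have hord : addOrderOf (⟨x, hxmem⟩ : AddCommGroup.primaryComponent G p) ∣ p ^ (k + 1) :=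
      (addOrderOf_dvd_natCard _).trans ((natCard_primaryComponent_point_adicCompletion_eq_pow W p w).symm ▸ hk)
    have h := addOrderOf_dvd_iff_nsmul_eq_zero.mp hord
    exact congrArg Subtype.val h

end Torsion

/-! ### §3 `#𝓕_can(w)_k = #E(ℚ_w)[p^{k+1}]`, `= #E(ℚ_w)[p^∞]` past the threshold -/

section Can

variable (k : ℕ) (w : HeightOneSpectrum (𝓞 ℚ))

/-- Transport of Milne's count along an equality of moduli `n = N`: `#𝓛_w(n) = #E(ℚ_w)[N] · #(ℤ_w/N)`.
[cite: MilneADT2006, I Lemma 3.3] -/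
theorem natCard_kummerSelmerStructure_inr_eq_of_eq (n : ℤ) (N : ℕ) (hN : N ≠ 0) (hn : n = N) :
    Nat.card (W.kummerSelmerStructure n (Sum.inr w)) =
      Nat.card (nsmulAddMonoidHom N :
          (W.baseChange (w.adicCompletion ℚ)).toAffine.Point →+ _).ker *
        Nat.card (w.adicCompletionIntegers ℚ ⧸ Ideal.span {((N : ℕ) : w.adicCompletionIntegers ℚ)}) := by
  subst hn
  exact W.natCard_kummerSelmerStructure_inr w hN

/-- **`#𝓕_can(w)_k = #E(ℚ_w)[p^{k+1}]`** at a finite `w ∤ p`: the propagated canonical condition is the local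
Kummer condition (n1011 `propagatedSelmerStructure_inr_eq_kummerSelmerStructure`), of order
`#E(ℚ_w)[p^{k+1}] · #(ℤ_w/p^{k+1}) = #E(ℚ_w)[p^{k+1}]` (`p` a unit at `w`). [cite: MilneADT2006, I Lemma 3.3]
[cite: Rubin2011, §3.1 (p. 29)] -/
theorem natCard_propagatedSelmerStructure_inr_eq_natCard_ker_nsmul (hw : ((p : ℕ) : 𝓞 ℚ) ∉ w.asIdeal) :
    Nat.card (propagatedSelmerStructure W p k (Sum.inr w)) =
      Nat.card (nsmulAddMonoidHom (p ^ (k + 1)) :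
          (W.baseChange (w.adicCompletion ℚ)).toAffine.Point →+ (W.baseChange (w.adicCompletion ℚ)).toAffine.Point).ker := by
  rw [propagatedSelmerStructure_inr_eq_kummerSelmerStructure W p k hw,
    natCard_kummerSelmerStructure_inr_eq_of_eq W w ((p : ℤ) ^ k * (p : ℤ)) (p ^ (k + 1))
      (pow_ne_zero _ hp.out.ne_zero) (by push_cast; ring)]
  have hu : IsUnit (((p ^ (k + 1) : ℕ) : ℕ) : w.adicCompletionIntegers ℚ) := by
    have h := HeightOneSpectrum.isUnit_algebraMap_adicCompletionIntegers ℚ w hw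
    rw [map_natCast] at h
    rw [Nat.cast_pow]
    exact h.pow _
  rw [AcSelmer.natCard_quotient_span_singleton_eq_one_of_isUnit hu, mul_one]

/-- **`#𝓕_can(w)_k = #E(ℚ_w)[p^∞] = p^{v_p(#E(ℚ_w)_tors)}` past the threshold** `#E(ℚ_w)[p^∞] ∣ p^{k+1}`.
[cite: MilneADT2006, I Lemma 3.3] -/
theorem natCard_propagatedSelmerStructure_inr_eq_pow_of_dvd (hw : ((p : ℕ) : 𝓞 ℚ) ∉ w.asIdeal)
    (hk : p ^ padicValNat p (Nat.card (AddCommGroup.torsion (W.baseChange (w.adicCompletion ℚ)).toAffine.Point)) ∣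
      p ^ (k + 1)) :
    Nat.card (propagatedSelmerStructure W p k (Sum.inr w)) =
      p ^ padicValNat p (Nat.card (AddCommGroup.torsion (W.baseChange (w.adicCompletion ℚ)).toAffine.Point)) := by
  rw [natCard_propagatedSelmerStructure_inr_eq_natCard_ker_nsmul W p k w hw, natCard_ker_nsmul_pow_eq_of_dvd W p w k hk]

end Can

/-! ### §4 THE ORDERS: `π_{k+1,*}` injective at deep levels, `#H¹(ℚ_w, T_pE) = #E(ℚ_w)[p^∞]`, `#H¹_ur` -/

section Orders

variable (w : HeightOneSpectrum (𝓞 ℚ))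

/-- Local notation: `T_pE|_{Γ_{ℚ_w}}` (= `tateLocalRep W p (Sum.inr w)`, by `rfl`). -/
local notation3 "𝕋" => (GaloisRep.restrictField (HeightOneSpectrum.adicCompletion ℚ w)
  (WeierstrassCurve.tateGaloisRep W p (W.continuous_galoisRepTate_holds p)).toIntRep)
/-- Local notation: the Tamagawa number `c_w` of the minimal model at `w`. -/
local notation3 "𝔠" => (WeierstrassCurve.baseChange W (HeightOneSpectrum.adicCompletion ℚ w)).localTamagawaNumber
  (HeightOneSpectrum.adicCompletionIntegers ℚ w)
/-- Local notation: `t_w = v_p(#E(ℚ_w)_tors)`, so that `#E(ℚ_w)[p^∞] = p^{t_w}`. -/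
local notation3 "𝔱" => padicValNat p (Nat.card (AddCommGroup.torsion
  (WeierstrassCurve.baseChange W (HeightOneSpectrum.adicCompletion ℚ w)).toAffine.Point))

/-- **`π_{k+1,*} : H¹(ℚ_w, T_pE) → H¹(ℚ_w, E[p^k · p])` is INJECTIVE at every level `k` with `#E(ℚ_w)[p^∞] ∣ p^{k+1}`**
(`w ∤ p`): a `T_pE`-class is determined by ONE deep reduction.  If `π_{k+1,*} y = 0` then every reduction
vanishes — below `k` by `red_*`, above `k` because `red_* : 𝓕_can(w)_j ↠ 𝓕_can(w)_k` (part XXVII) is a bijection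
between groups of the same order `#E(ℚ_w)[p^∞]` (§3) — and `y = 0` by §1 (`lim¹ = 0`).
[cite: Rubin2000, Lemma 1.3.5 and App. B Prop. B.2.3] [cite: MilneADT2006, I Lemma 3.3] -/
theorem tateLocalMap_injective_of_dvd (k : ℕ) (hw : ((p : ℕ) : 𝓞 ℚ) ∉ w.asIdeal) (hk : p ^ 𝔱 ∣ p ^ (k + 1)) :
    Function.Injective (tateLocalMap W p k (Sum.inr w)) := by
  refine (injective_iff_map_eq_zero _).mpr fun y h0 => ?_
  refine eq_zero_of_forall_tateLocalMap_eq_zero W p (Sum.inr w) y fun j => ?_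
  rcases le_or_gt j k with hjk | hjk
  · obtain ⟨red, hred⟩ := exists_torsionReduction_pow_mul W p j k
    rw [← localMap_red_tateLocalMap_apply W p hjk red hred (Sum.inr w), h0, map_zero]
  · obtain ⟨red, hred⟩ := exists_torsionReduction_pow_mul W p k j
    have hkj : k ≤ j := hjk.le
    have hj : p ^ 𝔱 ∣ p ^ (j + 1) := hk.trans (pow_dvd_pow p (by omega))
    haveI := KimAtThreeD7uTamagawaIndex.finite_propagatedSelmerStructure_inr W p j w hw
    have hmem : tateLocalMap W p j (Sum.inr w) y ∈ (⊥ : AddSubgroup _) := by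
      refine mem_of_mem_of_map_mem_of_relIndex_eq (DiscreteGaloisModule.localMap red (Sum.inr w))
        (S := ⊥) (S' := ⊥) bot_le
        (map_localMap_red_propagatedSelmerStructure W p hkj red hred (Sum.inr w))
        (by rw [AddSubgroup.map_bot]) ?_ ?_ ?_
      · rw [AddSubgroup.relIndex_bot_left, AddSubgroup.relIndex_bot_left,
          natCard_propagatedSelmerStructure_inr_eq_pow_of_dvd W p j w hw hj,
          natCard_propagatedSelmerStructure_inr_eq_pow_of_dvd W p k w hw hk]
      · exact (mem_propagatedSelmerStructure_iff W p j (Sum.inr w) _).mpr ⟨_, rfl⟩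
      · rw [localMap_red_tateLocalMap_apply W p hkj red hred (Sum.inr w), h0]
        exact zero_mem _
    exact (AddSubgroup.mem_bot).mp hmem

/-- **`#H¹(ℚ_w, T_pE) = p^{v_p(#E(ℚ_w)_tors)} = #E(ℚ_w)[p^∞]`** at every finite `w ∤ p` (any `p`, any reduction
type): `π_{k+1,*}` at a deep level is an injection with image `𝓕_can(w)_k`, of order `#E(ℚ_w)[p^∞]`.  The
integral shadow of «`H¹(ℚ_ℓ, V_pE) = 0`»; numerically Tate local duality `#H¹(ℚ_ℓ, T_pE) = #H²(ℚ_ℓ, T_pE) =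
#E(ℚ_ℓ)[p^∞]`, obtained without duality. [cite: Rubin2000, Lemma 1.3.5 and App. B Prop. B.2.3]
[cite: MilneADT2006, I Lemma 3.3, Cor. 2.3 and Thm. 2.8] -/
theorem natCard_cohomology_tate_eq_pow_padicValNat (hw : ((p : ℕ) : 𝓞 ℚ) ∉ w.asIdeal) :
    Nat.card ((tateLocalRep W p (Sum.inr w)).cohomology 1) = p ^ 𝔱 := by
  have hk : p ^ 𝔱 ∣ p ^ (𝔱 + 1) := pow_dvd_pow p (Nat.le_succ _)
  have hinj := tateLocalMap_injective_of_dvd W p w 𝔱 hw hk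
  rw [← natCard_propagatedSelmerStructure_inr_eq_pow_of_dvd W p 𝔱 w hw hk, propagatedSelmerStructure_eq_range,
    ← Nat.card_range_of_injective hinj]
  rfl

/-- The same with the `p`-primary part spelled out: `#H¹(ℚ_w, T_pE) = #E(ℚ_w)[p^∞]`. [cite: Rubin2000, Lemma 1.3.5]
[cite: MilneADT2006, I Cor. 2.3 and Thm. 2.8] -/
theorem natCard_cohomology_tate_eq_natCard_primaryComponent (hw : ((p : ℕ) : 𝓞 ℚ) ∉ w.asIdeal) :
    Nat.card ((tateLocalRep W p (Sum.inr w)).cohomology 1) =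
      Nat.card (AddCommGroup.primaryComponent (W.baseChange (w.adicCompletion ℚ)).toAffine.Point p) := by
  rw [natCard_cohomology_tate_eq_pow_padicValNat W p w hw, natCard_primaryComponent_point_adicCompletion_eq_pow W p w]

/-- **`H¹(ℚ_w, T_pE)` is FINITE at every finite `w ∤ p`** (the tree's form of «`H¹(ℚ_ℓ, V_pE) = 0`», so that
Bloch–Kato's `H¹_f(ℚ_w, T_pE)` is all of `H¹(ℚ_w, T_pE)` and the tree's relaxed propagation IS Mazur–Rubin's
`𝓕_can`). [cite: Rubin2000, Lemma 1.3.5] [cite: MilneADT2006, I Cor. 2.3 and Thm. 2.8] -/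
theorem finite_cohomology_tate (hw : ((p : ℕ) : 𝓞 ℚ) ∉ w.asIdeal) :
    Finite ((tateLocalRep W p (Sum.inr w)).cohomology 1) := by
  refine Nat.finite_of_card_ne_zero ?_
  rw [natCard_cohomology_tate_eq_pow_padicValNat W p w hw]
  exact pow_ne_zero _ hp.out.ne_zero

/-- **`#H¹_ur(ℚ_w, T_pE) · p^{v_p(c_w)} = p^{v_p(#E(ℚ_w)_tors)} = #E(ℚ_w)[p^∞]`** at every finite `w ∤ p` (part XXVIII's
index inside this file's order).  Classically `#H¹_ur(ℚ_w, T_pE) = #T^{I_w}/(Fr − 1)T^{I_w} = #Ẽ_ns(𝔽_w)[p^∞]` and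
`#E(ℚ_w)[p^∞] = #Ẽ_ns(𝔽_w)[p^∞] · (c_w)_p`. [cite: Rubin2000, Lemma 1.3.2 and Lemma 1.3.5] -/
theorem natCard_unramifiedSubgroup_tate_mul_pow_eq (hw : ((p : ℕ) : 𝓞 ℚ) ∉ w.asIdeal) :
    Nat.card (GaloisRep.unramifiedSubgroup (𝕋) 1) * p ^ padicValNat p 𝔠 = p ^ 𝔱 := by
  rw [← index_unramifiedSubgroup_tate_eq_pow_padicValNat W p w hw, AddSubgroup.card_mul_index]
  exact natCard_cohomology_tate_eq_pow_padicValNat W p w hw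

/-- **`p^{v_p(c_w)} ∣ #E(ℚ_w)[p^∞]`**: the `p`-part of the Tamagawa number at `w ∤ p` divides the order of the
`p`-power torsion of `E(ℚ_w)` — here a COROLLARY of Galois cohomology (`[H¹ : H¹_ur] ∣ #H¹`); classically
`E(ℚ_w)[p^∞] ↠ Φ_w(𝔽_w)[p^∞]` because `E₀(ℚ_w)` is `p`-divisible up to the finite `Ẽ_ns(𝔽_w)`.
[cite: Rubin2000, Lemma 1.3.5] [cite: SilvermanAEC2009, VII.6.1 and VII.6.3] -/
theorem pow_padicValNat_localTamagawaNumber_dvd_natCard_primaryComponent (hw : ((p : ℕ) : 𝓞 ℚ) ∉ w.asIdeal) :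
    p ^ padicValNat p 𝔠 ∣
      Nat.card (AddCommGroup.primaryComponent (W.baseChange (w.adicCompletion ℚ)).toAffine.Point p) := by
  rw [natCard_primaryComponent_point_adicCompletion_eq_pow W p w, ← natCard_unramifiedSubgroup_tate_mul_pow_eq W p w hw]
  exact Dvd.intro_left _ rfl

/-- In valuations: **`v_p(c_w) ≤ v_p(#E(ℚ_w)_tors)`** at every finite `w ∤ p`. [cite: Rubin2000, Lemma 1.3.5]
[cite: SilvermanAEC2009, VII.6.1 and VII.6.3] -/
theorem padicValNat_localTamagawaNumber_le (hw : ((p : ℕ) : 𝓞 ℚ) ∉ w.asIdeal) :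
    padicValNat p 𝔠 ≤ 𝔱 := by
  have h := pow_padicValNat_localTamagawaNumber_dvd_natCard_primaryComponent W p w hw
  rw [natCard_primaryComponent_point_adicCompletion_eq_pow W p w] at h
  exact (Nat.pow_dvd_pow_iff_le_right hp.out.one_lt).mp h

end Orders

end Summit.BirchSwinnertonDyer.BirchSwinnertonDyer.Theorems.KimAtThreeD7uTamagawaTateOrder

end
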